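import Summits.HodgeConjecture.HodgeConjecture.Theses.EndoscopicMiddleDegree
import Summits.HodgeConjecture.HodgeConjecture.Theorems.EndoscopicMiddleDegreeOrthogonalEnvelopedCorrAlgebra
import Summits.HodgeConjecture.HodgeConjecture.Theorems.EndoscopicMiddleDegreeIsotypicMiddleClassesAlgebraicStubIdempotentReduction
import Summits.HodgeConjecture.HodgeConjecture.Theorems.EndoscopicMiddleDegreeIsotypicMiddleClassesAlgebraicStubDetectionCriterion
import Literature.AlgebraicGeometry.HodgeTheory.ComplexGysinCorrespondence
import Literature.AlgebraicGeometry.HodgeTheory.SupportedHodgeClassDescent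
import Literature.AlgebraicTopology.SingularHomology.GysinMapSupportProofs
import Mathlib.AlgebraicGeometry.Morphisms.Finite
import Mathlib.AlgebraicGeometry.Morphisms.Etale

/-!
# Crux `IsotypicMiddleClassesAlgebraic` (stmt-HodgeConjecture-14301) — line `virtual-lefschetz-noncongruence`
(idea `virtual-lefschetz-noncongruence`, ideator 4, round 2; crux-plan skeleton 2026-08-16, RESHAPED by the
lead `prover-line-stmt-HodgeConjecture-14301-a3-0`, cycle 1)

The crux: for an orientation family `μ` with Poincaré duality, `m ∈ {1,2}` (`dim X = 2n`, `n = m+1`),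
a datum `D : UnitaryBallQuotientDatum (2n) X`, an algebraic `γ ∈ N^{2n} H^{4n}((X ⊗ X)(ℂ))` whose
action `P = γ_* = pr₁₊(pr₂^* – ∪ γ)` (H2) preserves rational classes and (H3) has purely `(n,n)`
image: every rational `c` with `P c = c` is algebraic.

THE LINE (card `Ideas/virtual-lefschetz-noncongruence.md`, line card `Lines/virtual-lefschetz-noncongruence.md`):
algebraic middle classes of `X` are manufactured as push-forwards `f_* w` of DIVISOR-POWER classes
`w` (cup products of `n` divisor classes, algebraic upstairs by Lefschetz `(1,1)`) along FINITE
covers `f : X' → X` that are étale off finitely many special divisors; detection of the pieces by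
such norm classes is turned into membership by an ENGINE of provable stubs.

RESHAPE (lead, cycle 1). The planner's engine went through the TRANSPOSED correspondence
`γᵗ = σ^* γ` (stubs S3 `stub_transposeAdjoint`, S4 `stub_detectionCriterion` with a cup-adjoint
`Q`, S5 with `Q c' = c'`). For an idempotent `P` on a space with a perfect pairing, the classes
fixed by the cup-adjoint `Q` are exactly the classes CUP-ORTHOGONAL TO `ker P` (`Im Q = (ker P)^⊥`),
so the transpose can be eliminated from every signature: S4 and S5 are restated with
"`c'` rational, `c' ≠ 0`, `c' ∪ x = 0` for every rational `x` with `P x = 0`" in place of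
"`Q c' = c'`", and S3 disappears (no swap `σ`, no orientation sign of `σ` on `(X ⊗ X)(ℂ)`, no
adjunction plumbing). On paper nothing changes (same set of `c'`); formally S5 only loses a
hypothesis it could not use. S1 (`stub_compositionClosure`) is PROVED here from the tree's
`exists_algebraic_corrAction_comp` (Theorems/EndoscopicMiddleDegreeOrthogonalEnvelopedCorrAlgebra,
landed for the sibling crux `OrthogonalEnveloped`) fed with the route support `CupProductAlgebraic`
on `X ⊗ (X ⊗ X)`. Remaining stubs: S2 `stub_idempotentReduction` (Fitting, delegated), S4
`stub_detectionCriterion` (rank count over `ℚ`, delegated), S5 `stub_virtualLefschetzSupply`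
(THE BET, the lead's).

* `stub_compositionClosure` (S1, PROVED): actions of algebraic self-correspondences of codimension
  `2n` on `X ⊗ X` are closed under composition.
* `stub_idempotentReduction` (S2, linear algebra — Fitting): granted S1, every admissible `γ` and
  rational `P`-fixed `c` admit an admissible IDEMPOTENT `γ'` with `P' c = c` (`P' = s(P) P^N`, a
  `ℚ`-polynomial in `P` without constant term).
* `stub_detectionCriterion` (S4, linear algebra — rank count over `ℚ`): for admissible idempotent
  `P`, if every non-zero rational `c'` cup-orthogonal to the rational part of `ker P` has
  `c' ∪ a ≠ 0` for some algebraic `a`, then every rational `P`-fixed class is algebraic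
  (`W' := (ker P_ℚ)^⊥ ≅ (Im P_ℚ)^*`, `W' ↪ Hom(Alg ∩ Im P_ℚ, ℚ)` by `⟨c', a⟩ = ⟨c', P a⟩` and
  `P(Alg) ⊆ Alg` (landed `stub_corrActionAlgebraic` p88732), so `dim Im P_ℚ ≤ dim (Alg ∩ Im P_ℚ)`).
* `stub_virtualLefschetzSupply` (S5, THE BET = (NC) of the card — PLAIN detection): for admissible
  idempotent `P` and a non-zero rational `c'` cup-orthogonal to the rational kernel of `P` there are
  a smooth projective `X'`, a morphism `f : X' ⟶ X` FINITE ÉTALE OVER THE COMPLEMENT OF FINITELY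
  MANY SPECIAL DIVISORS of `D`, and `w ∈ divisorPower X' n` with `c' ∪ f_* w ≠ 0`. H3 is used HERE
  (Disproof F3(a)): with `γ = [Δ_X]`, `P = id`, `ker P = 0`, every non-zero rational class
  qualifies and the statement is false on paper as soon as `H^{2n} ≠ Alg`.
* `isotypicMiddleClassesAlgebraic_of (h9 : CupProductAlgebraic) : IsotypicMiddleClassesAlgebraic` —
  the kernel-checked composition, concluding the crux BY NAME.
-/

noncomputable section

namespace Summit.HodgeConjecture.HodgeConjecture.Cruxes.IsotypicMiddleClassesAlgebraic.VirtualLefschetzNoncongruence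

set_option linter.dupNamespace false

open CategoryTheory MonoidalCategory CartesianMonoidalCategory AlgebraicGeometry
open Literature.AlgebraicGeometry Literature.AlgebraicGeometry.HodgeTheory
open Literature.AlgebraicGeometry.Motives
open Literature.AlgebraicGeometry.ShimuraVarieties Literature.AlgebraicTopology.SingularHomology
open Summit.HodgeConjecture.HodgeConjecture.Theses

/-! ### Divisor powers -/

/-- The span `D_k(Y) ⊆ H^{2k}(Y(ℂ); ℂ)` of the monomials `d₁ ∪ ⋯ ∪ d_k` in divisor classes
`dᵢ ∈ algebraicClasses Y 1` (`D_0 = H⁰`, `D_{k+1} = span {a ∪ d : a ∈ D_k, d ∈ N¹}`); on a finite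
cover of `X` the `dᵢ` are algebraic by Lefschetz `(1,1)` — the "virtual Lefschetz classes" of the
card (its `divisorPower`; ideator 5's / the lead's `divisorPowerSpan`). -/
def divisorPower (Y : SchemeOver ℂ) : (k : ℕ) → Submodule ℂ (complexBetti Y (2 * k))
  | 0 => ⊤
  | k + 1 => Submodule.span ℂ {z | ∃ a ∈ divisorPower Y k, ∃ d ∈ algebraicClasses Y 1,
      z = cupProduct (two_mul_add_two_mul k 1) a d}

/-- Divisor monomials are algebraic: `D_k(Y) ≤ algebraicClasses Y k` for `Y` smooth projective,
given the route support `CupProductAlgebraic` (stmt-HodgeConjecture-14350). -/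
theorem divisorPower_le_algebraicClasses (h9 : EndoscopicMiddleDegree.CupProductAlgebraic)
    {n : ℕ} {Y : SchemeOver ℂ} (hY : IsSmoothProjective n Y) :
    ∀ k, divisorPower Y k ≤ algebraicClasses Y k
  | 0 => by
      rw [algebraicClasses_zero]
      exact le_top
  | k + 1 => by
      refine Submodule.span_le.2 ?_
      rintro z ⟨a, ha, d, hd, rfl⟩
      exact h9 hY k 1 a d (divisorPower_le_algebraicClasses h9 hY k ha) hd

/-! ### Covers finite étale off finitely many special divisors -/

/-- The Zariski-open complement `X ∖ ⋃_{W ∈ S} c(W)` of the special divisors `c(W)`, `W ∈ S`, of a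
finite set `S` of totally positive `E`-lines of `V` (each `D.specialSubvariety W` is closed, field
`isClosed_specialSubvariety` of the datum). A morphism `f : X' ⟶ X` with `f ∣_ U` FINITE and ÉTALE
for such a `U` is a "cover finite étale off finitely many special divisors": `S = ∅` gives the
finite étale covers (non-congruence Kazhdan covers — card supplies S1/S2); `S ≠ ∅` admits the
RESOLVED cyclic covers branched along special-divisor configurations (card S3 / ideator 5's S2, the
triage's surviving supply). What this typing still excludes: modifications or ramification over
NON-special loci (the birational costume and the incidence-cover costume of
Lines/IdeatorFiveSketch-dead.md §2). What it lets in for free: push-forwards of monomials containing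
an exceptional divisor are supported on the removed special divisors, and non-dominant `f` with
image inside the removed divisors (`f⁻¹ U = ∅`) push divisor monomials of resolved special divisors
forward — classes in the theta world's second summand for `m = 1`, cycles on special divisors for
`m = 2`. -/
def specialDivisorComplement {p : ℕ} {X : SchemeOver ℂ} (D : UnitaryBallQuotientDatum p X)
    (S : Finset (Submodule D.E (Fin (p + 1) → D.E)))
    (hS : ∀ W ∈ S, IsTotallyPositive (conjRingHom D.E) D.H W ∧ Module.finrank D.E W = 1) :
    X.left.Opens :=
  ⟨(⋃ W ∈ S, D.specialSubvariety W)ᶜ,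
    (S.finite_toSet.isClosed_biUnion fun W hW ↦ D.isClosed_specialSubvariety W (hS W hW).1).isOpen_compl⟩

/-! ### S1 — composition of algebraic self-correspondences (engine, PROVED) -/

/-- **S1 (`stub_compositionClosure`, PROVED) — actions of algebraic self-correspondences compose.**
For `X` smooth projective of dimension `2n` (`n = m+1`) and algebraic
`γ₁, γ₂ ∈ N^{2n} H^{4n}((X ⊗ X)(ℂ))`, there is an algebraic `γ₃` of the same shape with
`(γ₃)_* = (γ₁)_* ∘ (γ₂)_*` on `H^{2n}(X(ℂ); ℂ)` — `γ₃ = c • p₁₃₊(p₁₂^* γ₂ ∪ p₂₃^* γ₁)` (Fulton,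
Intersection Theory, Prop. 16.1.1; Buskin 2019 Lemma 6.3): the tree's
`exists_algebraic_corrAction_comp` (Theorems/EndoscopicMiddleDegreeOrthogonalEnvelopedCorrAlgebra),
whose cup-product hypothesis on `X ⊗ (X ⊗ X)` is the route support `CupProductAlgebraic`. -/
theorem stub_compositionClosure (h9 : EndoscopicMiddleDegree.CupProductAlgebraic)
    (μ : OrientationFamily) (hμ : μ.HasPoincareDuality) (m : ℕ) (X : SchemeOver ℂ)
    (hX : IsSmoothProjective (2 * (m + 1)) X)
    (γ₁ : complexBetti (X ⊗ X) (2 * (2 * (m + 1))))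
    (hγ₁ : γ₁ ∈ algebraicClasses (X ⊗ X) (2 * (m + 1)))
    (γ₂ : complexBetti (X ⊗ X) (2 * (2 * (m + 1))))
    (hγ₂ : γ₂ ∈ algebraicClasses (X ⊗ X) (2 * (m + 1))) :
    ∃ γ₃ : complexBetti (X ⊗ X) (2 * (2 * (m + 1))),
      γ₃ ∈ algebraicClasses (X ⊗ X) (2 * (m + 1)) ∧
      ∀ β : complexBetti X (2 * (m + 1)),
        corrAction μ hX hX
            (rfl : 2 * (m + 1) + 2 * (2 * (m + 1)) = 2 * (m + 1) + 2 * (2 * (m + 1))) γ₃ β =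
          corrAction μ hX hX
            (rfl : 2 * (m + 1) + 2 * (2 * (m + 1)) = 2 * (m + 1) + 2 * (2 * (m + 1))) γ₁
            (corrAction μ hX hX
              (rfl : 2 * (m + 1) + 2 * (2 * (m + 1)) = 2 * (m + 1) + 2 * (2 * (m + 1))) γ₂ β) := by
  have hXXX : IsSmoothProjective (2 * (m + 1) + (2 * (m + 1) + 2 * (m + 1))) (X ⊗ (X ⊗ X)) :=
    IsSmoothProjective.tensor_holds hX (IsSmoothProjective.tensor_holds hX hX)
  obtain ⟨γ₃, hγ₃, h⟩ :=
    Cruxes.OrthogonalEnveloped.ImpureBarrenEnvelope.exists_algebraic_corrAction_comp hμ hX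
      (fun a ha b hb ↦ h9 hXXX (2 * (m + 1)) (2 * (m + 1)) a b ha hb) (2 * (m + 1)) hγ₁ hγ₂
  exact ⟨γ₃, hγ₃, fun β ↦ LinearMap.congr_fun h β⟩

/-! ### S2 — reduction to idempotent correspondences (engine, Fitting decomposition) -/

/-- **Stub S2 (`stub_idempotentReduction`) — it suffices to treat admissible IDEMPOTENTS.** Granted
composition closure (S1) on `X`: for an algebraic `γ` whose action `P` preserves rational classes
(H2) and has purely `(n,n)` image (H3), and a rational `c` with `P c = c`, there is an algebraic `γ'`
whose action `P'` again satisfies H2 and H3, is IDEMPOTENT, and fixes `c`. Proof on paper: `P` is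
defined over `ℚ` (`H = H_ℚ ⊗ ℂ`: `span_isRationalClass_eq_top_of_isSmoothProjective_holds`,
`linearIndependent_iff_of_isRationalClass`; descent `ratFit_exists_descent`); Fitting: factor
`minpoly_ℚ P_ℚ = X^a g`, `X ∤ g`, Bezout `u X^{a+1} + v g = 1`; `P' := (u X^{a+1})(P)` is an
idempotent `ℚ`-polynomial in `P` WITHOUT constant term (cf. `ratFit_exists_poly_idempotent`,
Theorems/EndoscopicMiddleDegreeOrthogonalEnvelopedRationalFitting), hence `P' = (γ')_*` with `γ'`
algebraic (S1 by induction on the degree + bilinearity of `corrAction`); `P' = P ∘ (…)` inherits H3,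
has `ℚ`-coefficients so inherits H2, and fixes every `P`-fixed `c`
(`(1 - P') c = (v g)(P) c = P^a (v g)(P) c = (v · minpoly)(P) c = 0`). Size M/L. -/
theorem stub_idempotentReduction (μ : OrientationFamily) (hμ : μ.HasPoincareDuality) (m : ℕ)
    (X : SchemeOver ℂ) (hX : IsSmoothProjective (2 * (m + 1)) X)
    (hcomp : ∀ γ₁ ∈ algebraicClasses (X ⊗ X) (2 * (m + 1)),
      ∀ γ₂ ∈ algebraicClasses (X ⊗ X) (2 * (m + 1)),
      ∃ γ₃ : complexBetti (X ⊗ X) (2 * (2 * (m + 1))),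
        γ₃ ∈ algebraicClasses (X ⊗ X) (2 * (m + 1)) ∧
        ∀ β : complexBetti X (2 * (m + 1)),
          corrAction μ hX hX
              (rfl : 2 * (m + 1) + 2 * (2 * (m + 1)) = 2 * (m + 1) + 2 * (2 * (m + 1))) γ₃ β =
            corrAction μ hX hX
              (rfl : 2 * (m + 1) + 2 * (2 * (m + 1)) = 2 * (m + 1) + 2 * (2 * (m + 1))) γ₁
              (corrAction μ hX hX
                (rfl : 2 * (m + 1) + 2 * (2 * (m + 1)) = 2 * (m + 1) + 2 * (2 * (m + 1))) γ₂ β))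
    (γ : complexBetti (X ⊗ X) (2 * (2 * (m + 1))))
    (hγ : γ ∈ algebraicClasses (X ⊗ X) (2 * (m + 1)))
    (hPrat : ∀ β, IsRationalClass β → IsRationalClass (corrAction μ hX hX
      (rfl : 2 * (m + 1) + 2 * (2 * (m + 1)) = 2 * (m + 1) + 2 * (2 * (m + 1))) γ β))
    (hPhdg : ∀ β, IsOfHodgeType (2 * (m + 1)) X (2 * (m + 1)) (m + 1) (m + 1)
      (corrAction μ hX hX
        (rfl : 2 * (m + 1) + 2 * (2 * (m + 1)) = 2 * (m + 1) + 2 * (2 * (m + 1))) γ β))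
    (c : complexBetti X (2 * (m + 1))) (hc : IsRationalClass c)
    (hPc : corrAction μ hX hX
      (rfl : 2 * (m + 1) + 2 * (2 * (m + 1)) = 2 * (m + 1) + 2 * (2 * (m + 1))) γ c = c) :
    ∃ γ' : complexBetti (X ⊗ X) (2 * (2 * (m + 1))),
      γ' ∈ algebraicClasses (X ⊗ X) (2 * (m + 1)) ∧
      (∀ β, IsRationalClass β → IsRationalClass (corrAction μ hX hX
        (rfl : 2 * (m + 1) + 2 * (2 * (m + 1)) = 2 * (m + 1) + 2 * (2 * (m + 1))) γ' β)) ∧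
      (∀ β, IsOfHodgeType (2 * (m + 1)) X (2 * (m + 1)) (m + 1) (m + 1)
        (corrAction μ hX hX
          (rfl : 2 * (m + 1) + 2 * (2 * (m + 1)) = 2 * (m + 1) + 2 * (2 * (m + 1))) γ' β)) ∧
      (∀ β, corrAction μ hX hX
          (rfl : 2 * (m + 1) + 2 * (2 * (m + 1)) = 2 * (m + 1) + 2 * (2 * (m + 1))) γ'
          (corrAction μ hX hX
            (rfl : 2 * (m + 1) + 2 * (2 * (m + 1)) = 2 * (m + 1) + 2 * (2 * (m + 1))) γ' β) =
        corrAction μ hX hX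
          (rfl : 2 * (m + 1) + 2 * (2 * (m + 1)) = 2 * (m + 1) + 2 * (2 * (m + 1))) γ' β) ∧
      corrAction μ hX hX
        (rfl : 2 * (m + 1) + 2 * (2 * (m + 1)) = 2 * (m + 1) + 2 * (2 * (m + 1))) γ' c = c := by
  exact Theorems.stub_idempotentReduction μ hμ m X hX hcomp γ hγ hPrat hPhdg c hc hPc

/-! ### S4 — plain detection of the classes orthogonal to `ker P` forces algebraicity (engine) -/

/-- **Stub S4 (`stub_detectionCriterion`) — from ONE detecting algebraic class per class
cup-orthogonal to the kernel to algebraicity of the whole fixed space.** For `X` smooth projective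
of dimension `2n`, an algebraic `γ` whose action `P` preserves rational classes and is IDEMPOTENT:
if every non-zero rational `c'` with `c' ∪ x = 0` for all RATIONAL `x ∈ ker P` has `c' ∪ a ≠ 0` for
some algebraic `a`, then every rational `P`-fixed class is algebraic. Proof on paper (linear algebra
over `ℚ`; no Hodge–Riemann, no Standard Conjecture, no transpose): descend `P` to `P_ℚ` on
`V = H^{2n}(X(ℂ); ℚ)` (`ratFit_exists_descent`; `V ⊗ ℂ = H`, `ofRatClassBaseChangeEquiv`), an
idempotent with `V = K ⊕ W`, `K = ker P_ℚ`, `W = Im P_ℚ = {rational fixed classes}`; the rational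
cup pairing `b` on `V` is perfect (`isPerfPair_cupPairing_of_field_holds` for a `ℚ`-orientation,
`Motives.ComplexPoints.isOrientableOver ℚ`; it is the complex pairing up to the orientation scalar,
`cupPairing_ringChange_ringChange`), so `W' := K^{⊥_b}` has `dim W' = dim V - dim K = dim W`. Let
`A := W ∩ Alg_ℚ`. For `c' ∈ W'` and a rational algebraic `a`, `b(c', a) = b(c', P a)` (`a - P a ∈ K`)
with `P a ∈ A` (`P(Alg) ⊆ Alg`, landed `stub_corrActionAlgebraic` p88732 from `CupProductAlgebraic`;
idempotence); algebraic classes are `ℂ`-combinations of rational algebraic ones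
(`supportedClasses_le_span_isRationalClass`), so the hypothesis makes `c' ↦ b(c', –)|_A` injective on
`W'`: `dim W = dim W' ≤ dim A ≤ dim W`, `A = W`, and every rational fixed `c` lies in `A ⊆ Alg`.
Size M/L. -/
theorem stub_detectionCriterion (h9 : EndoscopicMiddleDegree.CupProductAlgebraic)
    (μ : OrientationFamily) (hμ : μ.HasPoincareDuality) (m : ℕ) (X : SchemeOver ℂ)
    (hX : IsSmoothProjective (2 * (m + 1)) X)
    (γ : complexBetti (X ⊗ X) (2 * (2 * (m + 1))))
    (hγ : γ ∈ algebraicClasses (X ⊗ X) (2 * (m + 1)))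
    (hPrat : ∀ β, IsRationalClass β → IsRationalClass (corrAction μ hX hX
      (rfl : 2 * (m + 1) + 2 * (2 * (m + 1)) = 2 * (m + 1) + 2 * (2 * (m + 1))) γ β))
    (hPidem : ∀ β, corrAction μ hX hX
        (rfl : 2 * (m + 1) + 2 * (2 * (m + 1)) = 2 * (m + 1) + 2 * (2 * (m + 1))) γ
        (corrAction μ hX hX
          (rfl : 2 * (m + 1) + 2 * (2 * (m + 1)) = 2 * (m + 1) + 2 * (2 * (m + 1))) γ β) =
      corrAction μ hX hX
        (rfl : 2 * (m + 1) + 2 * (2 * (m + 1)) = 2 * (m + 1) + 2 * (2 * (m + 1))) γ β)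
    (hdet : ∀ c' : complexBetti X (2 * (m + 1)), IsRationalClass c' → c' ≠ 0 →
      (∀ x : complexBetti X (2 * (m + 1)), IsRationalClass x →
        corrAction μ hX hX
          (rfl : 2 * (m + 1) + 2 * (2 * (m + 1)) = 2 * (m + 1) + 2 * (2 * (m + 1))) γ x = 0 →
        cupProduct (two_mul_add_two_mul (m + 1) (m + 1)) c' x = 0) →
      ∃ a ∈ algebraicClasses X (m + 1), cupProduct (two_mul_add_two_mul (m + 1) (m + 1)) c' a ≠ 0)
    (c : complexBetti X (2 * (m + 1))) (hc : IsRationalClass c)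
    (hPc : corrAction μ hX hX
      (rfl : 2 * (m + 1) + 2 * (2 * (m + 1)) = 2 * (m + 1) + 2 * (2 * (m + 1))) γ c = c) :
    c ∈ algebraicClasses X (m + 1) := by
  exact Theorems.stub_detectionCriterion h9 μ hμ m X hX γ hγ hPrat hPidem hdet c hc hPc

/-! ### S5 — THE SUPPLY: virtual Lefschetz classes detect the classes orthogonal to `ker P` (the bet) -/

/-- **Stub S5 (`stub_virtualLefschetzSupply`) — (NC) of the card: plain detection by norms of
divisor powers from covers finite étale off special divisors.** For `μ` with Poincaré duality,
`m ∈ {1,2}`, a datum `D` on `X` (`dim X = 2n`, `n = m+1`), an algebraic `γ` whose action `P`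
preserves rational classes (H2), has purely `(n,n)` image (H3) and is idempotent, and a non-zero
rational class `c'` CUP-ORTHOGONAL TO THE RATIONAL KERNEL of `P` (equivalently: fixed by the
cup-adjoint of `P`; for the route's `*`-closed Hecke idempotents these are the classes of the piece
`Im P` itself): there are a smooth projective `X'` of dimension `2n`, a morphism `f : X' ⟶ X`,
finitely many special divisors `c(W)`, `W ∈ S`, OFF WHICH `f` IS FINITE ÉTALE (`f ∣_ U` finite and
étale, `U = specialDivisorComplement D S hS`), and a divisor-power class `w ∈ D_n(X')` with
`c' ∪ f_* w ≠ 0`. Intended witnesses: norms of products of EXOTIC divisor classes — outside the span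
of pulled-back and geodesic divisors, which are blind (`DivisorialInvisibility`, ideator 5;
geodesic blindness, TRIAGE-r2-3 App. A) — on non-congruence Kazhdan covers (`b₁ > 0` ⟹ ¬CSP for
every type-one datum, both `m`; `S = ∅`) or on resolved cyclic covers branched along special-divisor
configurations (ideator 5's F2; `S` = the branch divisors). H3 is load-bearing here (with
`γ = [Δ_X]`, `P = id`, `ker P = 0`, every non-zero rational class qualifies and the statement fails
on paper once `H^{2n} ≠ Alg`). OPEN, and NOT implied by HC (over all admissible `P` it says: the
norm classes `f_* D_n(X')` span the algebraic middle classes of `X` up to numerical equivalence —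
"compact ball quotients are virtually Lefschetz in the middle degree"); refutable on paper only by a
new rigidity / vanishing theorem off the congruence world. Size XL. -/
theorem stub_virtualLefschetzSupply (μ : OrientationFamily) (hμ : μ.HasPoincareDuality) (m : ℕ)
    (X : SchemeOver ℂ) (D : UnitaryBallQuotientDatum (2 * (m + 1)) X) (h1 : 1 ≤ m) (h2 : m ≤ 2)
    (γ : complexBetti (X ⊗ X) (2 * (2 * (m + 1))))
    (hγ : γ ∈ algebraicClasses (X ⊗ X) (2 * (m + 1)))
    (hPrat : ∀ β, IsRationalClass β → IsRationalClass (corrAction μ D.isSmoothProjective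
      D.isSmoothProjective (rfl : 2 * (m + 1) + 2 * (2 * (m + 1)) = 2 * (m + 1) + 2 * (2 * (m + 1))) γ β))
    (hPhdg : ∀ β, IsOfHodgeType (2 * (m + 1)) X (2 * (m + 1)) (m + 1) (m + 1)
      (corrAction μ D.isSmoothProjective D.isSmoothProjective
        (rfl : 2 * (m + 1) + 2 * (2 * (m + 1)) = 2 * (m + 1) + 2 * (2 * (m + 1))) γ β))
    (hPidem : ∀ β, corrAction μ D.isSmoothProjective D.isSmoothProjective
        (rfl : 2 * (m + 1) + 2 * (2 * (m + 1)) = 2 * (m + 1) + 2 * (2 * (m + 1))) γ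
        (corrAction μ D.isSmoothProjective D.isSmoothProjective
          (rfl : 2 * (m + 1) + 2 * (2 * (m + 1)) = 2 * (m + 1) + 2 * (2 * (m + 1))) γ β) =
      corrAction μ D.isSmoothProjective D.isSmoothProjective
        (rfl : 2 * (m + 1) + 2 * (2 * (m + 1)) = 2 * (m + 1) + 2 * (2 * (m + 1))) γ β)
    (c' : complexBetti X (2 * (m + 1))) (hc' : IsRationalClass c')
    (hc'K : ∀ x : complexBetti X (2 * (m + 1)), IsRationalClass x →
      corrAction μ D.isSmoothProjective D.isSmoothProjective
        (rfl : 2 * (m + 1) + 2 * (2 * (m + 1)) = 2 * (m + 1) + 2 * (2 * (m + 1))) γ x = 0 →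
      cupProduct (two_mul_add_two_mul (m + 1) (m + 1)) c' x = 0)
    (hc'0 : c' ≠ 0) :
    ∃ (X' : SchemeOver ℂ) (hX' : IsSmoothProjective (2 * (m + 1)) X') (f : X' ⟶ X)
      (S : Finset (Submodule D.E (Fin (2 * (m + 1) + 1) → D.E)))
      (hS : ∀ W ∈ S, IsTotallyPositive (conjRingHom D.E) D.H W ∧ Module.finrank D.E W = 1),
      IsFinite (f.left ∣_ specialDivisorComplement D S hS) ∧
      Etale (f.left ∣_ specialDivisorComplement D S hS) ∧
      ∃ w ∈ divisorPower X' (m + 1),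
        cupProduct (two_mul_add_two_mul (m + 1) (m + 1)) c'
          (complexGysin μ hX' D.isSmoothProjective f
            (rfl : 2 * (m + 1) + 2 * (2 * (m + 1)) = 2 * (m + 1) + 2 * (2 * (m + 1))) w) ≠ 0 := by
  sorry

/-! ### Composition -/

/-- **Line `virtual-lefschetz-noncongruence` closes the crux modulo its stubs**: given the route
support `CupProductAlgebraic` (stmt-HodgeConjecture-14350), S1 (proved), S2, S4, S5 imply
`IsotypicMiddleClassesAlgebraic`. Reduce `γ` to an admissible idempotent `γ'` fixing `c` (S2 fed
with S1); every non-zero rational class cup-orthogonal to the rational kernel of `P'` is plainly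
detected by the push-forward of a divisor-power class from a cover finite étale off special
divisors (S5), and that push-forward is algebraic (`divisorPower_le_algebraicClasses` +
`complexGysin_mem_algebraicClasses` with the proved `gysinMap_restrictCompl_eq_zero_of_field ℂ`); so
the whole rational fixed space of `P'` is algebraic (S4), in particular `c`. -/
theorem isotypicMiddleClassesAlgebraic_of (h9 : EndoscopicMiddleDegree.CupProductAlgebraic) :
    EndoscopicMiddleDegree.IsotypicMiddleClassesAlgebraic := by
  intro μ hμ m X D h1 h2 γ hγ P hPrat hPhdg c hc hPc
  obtain ⟨γ', hγ', hP'rat, hP'hdg, hP'idem, hP'c⟩ :=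
    stub_idempotentReduction μ hμ m X D.isSmoothProjective
      (fun γ₁ hγ₁ γ₂ hγ₂ ↦ stub_compositionClosure h9 μ hμ m X D.isSmoothProjective γ₁ hγ₁ γ₂ hγ₂)
      γ hγ hPrat hPhdg c hc hPc
  refine stub_detectionCriterion h9 μ hμ m X D.isSmoothProjective γ' hγ' hP'rat hP'idem ?_ c hc hP'c
  intro c' hc' hc'0 hc'K
  obtain ⟨X', hX', f, -, -, -, -, w, hw, hne⟩ :=
    stub_virtualLefschetzSupply μ hμ m X D h1 h2 γ' hγ' hP'rat hP'hdg hP'idem c' hc' hc'K hc'0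
  exact ⟨_, complexGysin_mem_algebraicClasses (gysinMap_restrictCompl_eq_zero_of_field ℂ) μ hμ hX'
    D.isSmoothProjective f (q := m + 1) (p := m + 1) rfl _
    (divisorPower_le_algebraicClasses h9 hX' (m + 1) hw), hne⟩

end Summit.HodgeConjecture.HodgeConjecture.Cruxes.IsotypicMiddleClassesAlgebraic.VirtualLefschetzNoncongruence

end
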